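import Literature.MathematicalPhysics.QuantumFieldTheory.LatticeMaxwellFreeEnergyLimit
import HarnessLib

/-!
# `FreeEnergyRate` (crux `stmt-QuantumFields-22402`), line `birth`, stub `maxwellRate`

Route `EntropyBudgetEquipartition` of `QuantumFields/YangMills`, crux
`Summit.QuantumFields.YangMills.Theses.EntropyBudgetEquipartition.FreeEnergyRate` (Chatterjee's
two-term free-energy asymptotics with a power rate).

A RATE for Theorem 15.2 of S. Chatterjee, *The leading term of the Yang–Mills free energy*,
arXiv:1602.01222: the axial-gauge lattice Maxwell free energy per site `log Z_M(B_n)/n^d`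
converges to its limit `L` at rate `n^{-1/2}`. The tree's proof of Theorem 15.2
(`LatticeMaxwell.tendsto_logZM_div`) is already quantitative: the dyadic subsequence has geometric
increments `|f(2^{k+1}+1) − f(2^k+1)| ≤ C((d+1)(k+2) + 2d+4)/2^k` (`abs_fM_dyadic_le`) and every
`l ≥ 3` is within `2C((d+1)(2k+2) + 2d+4)/2^k` of `f(2^k+1)`, `2^k ≤ l−1 < 2^{k+1}`
(`abs_fM_sub_dyadic_le`). Bounding `k + 2 ≤ 3·√2^k` (Bernoulli) turns both into `O(√2^{-k})`,
the geometric tail is summed by `dist_le_of_le_geometric_of_tendsto`, and `√2^{-k} ≤ 2/√l`.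
No definitions, no named facts.
-/

noncomputable section

namespace Summit.QuantumFields.YangMills.Theorems.FreeEnergyRate

open Filter Topology
open Literature.MathematicalPhysics.QuantumFieldTheory
open Literature.MathematicalPhysics.QuantumFieldTheory.LatticeMaxwell

/-- `k + 2 ≤ 3 √2^k` (Bernoulli's inequality with `√2 − 1 > 0.41`). [folklore] -/
theorem add_two_le_three_mul_sqrt_two_pow (k : ℕ) : (k : ℝ) + 2 ≤ 3 * Real.sqrt 2 ^ k := by
  have hs : (1.41 : ℝ) < Real.sqrt 2 := (Real.lt_sqrt (by norm_num)).2 (by norm_num)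
  have hB : 1 + (k : ℝ) * (Real.sqrt 2 - 1) ≤ (1 + (Real.sqrt 2 - 1)) ^ k :=
    one_add_mul_le_pow (by linarith) k
  rw [add_sub_cancel] at hB
  have hk : (0 : ℝ) ≤ k := Nat.cast_nonneg k
  nlinarith

/-- `(A(k+2) + B)/2^k ≤ (3A + B)(1/√2)^k` for `A, B ≥ 0`. [folklore] -/
theorem lin_div_two_pow_le {A B : ℝ} (hA : 0 ≤ A) (hB : 0 ≤ B) (k : ℕ) :
    (A * ((k : ℝ) + 2) + B) / 2 ^ k ≤ (3 * A + B) * ((Real.sqrt 2)⁻¹) ^ k := by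
  set s : ℝ := Real.sqrt 2 ^ k with hs
  have hs0 : 0 < s := by rw [hs]; positivity
  have hs1 : 1 ≤ s := one_le_pow₀ (Real.one_le_sqrt.2 (by norm_num))
  have h2 : (2 : ℝ) ^ k = s * s := by
    rw [hs, ← mul_pow, Real.mul_self_sqrt (by norm_num)]
  have hk := add_two_le_three_mul_sqrt_two_pow k
  rw [h2, inv_pow, ← hs, div_le_iff₀ (by positivity)]
  have e : (3 * A + B) * s⁻¹ * (s * s) = (3 * A + B) * s := by
    field_simp
  rw [e]
  nlinarith [mul_le_mul_of_nonneg_left hk hA, mul_le_mul_of_nonneg_left hs1 hB]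

/-- `1/√2 < 1` and `1 − 1/√2 ≥ 1/4`. [folklore] -/
theorem inv_sqrt_two_bounds : (Real.sqrt 2)⁻¹ < 1 ∧ 1 / 4 ≤ 1 - (Real.sqrt 2)⁻¹ := by
  have hs : (4 / 3 : ℝ) < Real.sqrt 2 := (Real.lt_sqrt (by norm_num)).2 (by norm_num)
  have h0 : (0 : ℝ) < Real.sqrt 2 := by positivity
  have h1 : (Real.sqrt 2)⁻¹ < 3 / 4 := by
    rw [inv_lt_comm₀ h0 (by norm_num)]
    linarith
  exact ⟨by linarith, by linarith⟩

/-- **Stub `maxwellRate` of line `birth`** (rate in Theorem 15.2): if `log Z_M(B_n)/n^d → L` then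
`|log Z_M(B_n)/n^d − L| ≤ C/√n` for all `n ≥ 1`. [cite: arXiv160201222, Thm. 15.2 (proof)] -/
theorem stub_maxwellRate {d : ℕ} (hd : 1 ≤ d) {L : ℝ}
    (hL : Tendsto (fun n : ℕ => ChatterjeeAssembly.logZM d n / (n : ℝ) ^ d) atTop (𝓝 L)) :
    ∃ C : ℝ, ∀ n : ℕ, 1 ≤ n →
      |ChatterjeeAssembly.logZM d n / (n : ℝ) ^ d - L| ≤ C / Real.sqrt n := by
  have hL' : Tendsto (fM d) atTop (𝓝 L) := hL
  set r : ℝ := (Real.sqrt 2)⁻¹ with hr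
  obtain ⟨hr1, hr4⟩ := inv_sqrt_two_bounds
  have hr0 : 0 < r := by rw [hr]; positivity
  have hC : 0 ≤ Cke d := by unfold Cke; positivity
  have hd0 : (0 : ℝ) ≤ d := Nat.cast_nonneg d
  -- the dyadic subsequence and its geometric increments
  set g : ℕ → ℝ := fun k => fM d (2 ^ k + 1) with hg
  have hglim : Tendsto g atTop (𝓝 L) := by
    refine hL'.comp ?_
    exact (tendsto_add_atTop_nat 1).comp (tendsto_pow_atTop_atTop_of_one_lt one_lt_two)
  set M : ℝ := Cke d * (5 * d + 7) with hM
  have hstep : ∀ k : ℕ, dist (g k) (g (k + 1)) ≤ M * r ^ k := by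
    intro k
    rw [Real.dist_eq, abs_sub_comm]
    refine (abs_fM_dyadic_le (d := d) hd k).trans ?_
    have h := lin_div_two_pow_le (A := Cke d * ((d : ℝ) + 1)) (B := Cke d * (2 * d + 4))
      (by positivity) (by positivity) k
    have e1 : Cke d * (((d : ℝ) + 1) * (k + 2) + (2 * d + 4)) / 2 ^ k =
        (Cke d * ((d : ℝ) + 1) * ((k : ℝ) + 2) + Cke d * (2 * d + 4)) / 2 ^ k := by ring
    have e2 : (3 * (Cke d * ((d : ℝ) + 1)) + Cke d * (2 * d + 4)) = M := by rw [hM]; ring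
    rw [e1]; rw [e2] at h; exact h
  have htail : ∀ k : ℕ, |g k - L| ≤ 4 * M * r ^ k := by
    intro k
    have h := dist_le_of_le_geometric_of_tendsto r M hr1 hstep hglim k
    rw [Real.dist_eq] at h
    refine h.trans ?_
    rw [div_le_iff₀ (by linarith)]
    have : 0 ≤ M * r ^ k := by positivity
    nlinarith
  -- the constant
  set M₀ : ℝ := d * Lc d 2 + |L| with hM₀
  have hM₀0 : 0 ≤ M₀ := by have := Lc_nonneg (d := d) 2; positivity
  refine ⟨2 * (Cke d * (36 * d + 48)) + 2 * M₀, fun n hn => ?_⟩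
  show |fM d n - L| ≤ _
  have hn0 : (0 : ℝ) < n := by exact_mod_cast hn
  have hsq0 : 0 < Real.sqrt n := Real.sqrt_pos.2 hn0
  by_cases h3 : 3 ≤ n
  · -- `n ≥ 3`: through the dyadic point `2^k + 1`, `k = ⌊log₂(n-1)⌋`
    set k := Nat.log 2 (n - 1) with hk
    have hcmp := abs_fM_sub_dyadic_le (d := d) hd h3
    rw [← hk] at hcmp
    have hcmp' : |fM d n - g k| ≤ Cke d * (16 * d + 20) * r ^ k := by
      refine hcmp.trans ?_
      have hmono : 2 * Cke d * (((d : ℝ) + 1) * (2 * k + 2) + (2 * d + 4)) / 2 ^ k ≤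
          (4 * Cke d * ((d : ℝ) + 1) * ((k : ℝ) + 2) + 2 * Cke d * (2 * d + 4)) / 2 ^ k := by
        apply div_le_div_of_nonneg_right _ (by positivity)
        have hk0 : (0 : ℝ) ≤ k := Nat.cast_nonneg k
        have : (0 : ℝ) ≤ 2 * Cke d * ((d : ℝ) + 1) := by positivity
        nlinarith
      refine hmono.trans ?_
      have h := lin_div_two_pow_le (A := 4 * Cke d * ((d : ℝ) + 1)) (B := 2 * Cke d * (2 * d + 4))
        (by positivity) (by positivity) k
      have e2 : (3 * (4 * Cke d * ((d : ℝ) + 1)) + 2 * Cke d * (2 * d + 4)) = Cke d * (16 * d + 20) := by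
        ring
      rw [e2] at h; exact h
    have hk2 : |fM d n - L| ≤ Cke d * (36 * d + 48) * r ^ k := by
      calc |fM d n - L| = |(fM d n - g k) + (g k - L)| := by ring_nf
        _ ≤ |fM d n - g k| + |g k - L| := abs_add_le _ _
        _ ≤ Cke d * (16 * d + 20) * r ^ k + 4 * M * r ^ k := add_le_add hcmp' (htail k)
        _ = Cke d * (36 * d + 48) * r ^ k := by rw [hM]; ring
    -- `r^k ≤ 2/√n` from `n - 1 < 2^(k+1)`
    have hpow : n - 1 < 2 ^ (k + 1) := Nat.lt_pow_succ_log_self (by norm_num) _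
    have hn4 : (n : ℝ) ≤ 4 * 2 ^ k := by
      have : n ≤ 4 * 2 ^ k := by rw [pow_succ] at hpow; omega
      exact_mod_cast this
    have hrk : r ^ k ≤ 2 / Real.sqrt n := by
      have hs2 : (2 : ℝ) ^ k = Real.sqrt 2 ^ k * Real.sqrt 2 ^ k := by
        rw [← mul_pow, Real.mul_self_sqrt (by norm_num)]
      have hspos : 0 < Real.sqrt 2 ^ k := by positivity
      have hsqrt : Real.sqrt n ≤ 2 * Real.sqrt 2 ^ k := by
        rw [Real.sqrt_le_left (by positivity)]
        nlinarith
      rw [hr, inv_pow, le_div_iff₀ hsq0]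
      calc (Real.sqrt 2 ^ k)⁻¹ * Real.sqrt n ≤ (Real.sqrt 2 ^ k)⁻¹ * (2 * Real.sqrt 2 ^ k) :=
            mul_le_mul_of_nonneg_left hsqrt (by positivity)
        _ = 2 := by field_simp
    calc |fM d n - L| ≤ Cke d * (36 * d + 48) * r ^ k := hk2
      _ ≤ Cke d * (36 * d + 48) * (2 / Real.sqrt n) := by gcongr
      _ = 2 * (Cke d * (36 * d + 48)) / Real.sqrt n := by ring
      _ ≤ (2 * (Cke d * (36 * d + 48)) + 2 * M₀) / Real.sqrt n := by gcongr; linarith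
  · -- `n ∈ {1, 2}`
    push Not at h3
    have hn2 : n ≤ 2 := by omega
    have hf : |fM d n| ≤ d * Lc d n := abs_fM_le hn
    have hLc : Lc d n ≤ Lc d 2 := Lc_mono hn2
    have hb : |fM d n - L| ≤ M₀ := by
      calc |fM d n - L| ≤ |fM d n| + |L| := abs_sub _ _
        _ ≤ d * Lc d n + |L| := by linarith
        _ ≤ M₀ := by rw [hM₀]; nlinarith
    have hsqrt2 : Real.sqrt n ≤ 2 := by
      rw [Real.sqrt_le_left (by norm_num)]
      have : (n : ℝ) ≤ 2 := by exact_mod_cast hn2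
      linarith
    rw [le_div_iff₀ hsq0]
    have : 0 ≤ 2 * (Cke d * (36 * d + 48)) := by positivity
    nlinarith [abs_nonneg (fM d n - L)]

end Summit.QuantumFields.YangMills.Theorems.FreeEnergyRate

end
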